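import Summits.Ventures.Crystal3D.Theorems.StickyWulffConstantNoReconstructionGainOneOverhangLocal
import Summits.Ventures.Crystal3D.Theorems.StickyWulffConstantNoReconstructionGainNTiltBarlowFilm
import HarnessLib

/-!
# Single-family Barlow films with ONE overhanging registry slot (`C = 1`): the `A`-rule certifies

HONEST FRAMING. Part of the venture `Summits/Ventures/Crystal3D` (cell `crystal3d-full`), helper
`--supports` the crux `NoReconstructionGain` (stmt-Ventures-19144, route
`route-Ventures-StickyWulffConstant`), line `adhesion`; continuation of `…OneOverhangLocal`
(`aRule_T2_core`), `…NTiltBarlowFilm` (regime `C = 0`) and `…WindowBarlowFilm`.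

Regime `C = 1`: with `α = √(2/3) ν₃ ≥ 0` and `β_τ = ⟪τ, ν⟫` on the hollow triple
`T = {w, w − u, w − v}`: exactly one `τ_a` has `α + β_{τ_a} < 0`, the other two have `α + β > 0`
(about `45 %` of all directions per family: the window, and the lobes `A−`, `B+` around the
anti-hollow azimuths where the plain `ν`-height and the layer order both fail).  Certificate: the
position-independent FLOW `t x y = s(x − y) − s(y − x)` of the `A`-rule
(`A = {N + τ_a, N − τ_b, −(N + τ_b), −(N + τ_c), −(N − τ_a), −(N − τ_c)}`, in-plane by `ν`), fed to
`adhesion_of_flow`.  Substrate partners never sit at a `−A` slot: four of the six are `ν`-upward, and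
the two twin slots `−(N − τ_b)` (a twin ball ON a substrate ball) and `N − τ_c` (a twin ball UNDER
one) are excluded by the substrate's one-step closure — the lattice points `p + N + τ_a`, resp.
`p − N − τ_b`, lie `√(1/3)` from the film ball:

* `oneOverhang_main` — the inequality for given `X ⊇ P` (abstract labels `τ_a, τ_b, τ_c`);
* `oneOverhangBarlowFilm_adhesion` (**the rung**, `R = 1`, `C = 0`; registered by name): for every
  unit `ν` with `ν₃ ≥ 0` in regime `C = 1`, every finite unit packing `X ⊇ P` around the `ν`-slab
  sample whose film lies in `B = Λ₀ ∪ (Λ₀ ± w)` and above the cut, and whose film-adjacent substrate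
  balls have all `ν`-downward lattice neighbours in `P` (the slab sample off its lateral rim):
  `#cross(P, X \ P) ≤ contactDeficiency (X \ P)`.

With `…NTiltBarlowFilm` (`C = 0`) this leaves, for single-family films in closure form, only the
regime `C = 2` (the analogous `M`-rule; next file).  Numbers: lead folder calc/slotrule.py — the
`A`-rule certifies every `B`-film situation at all 414 grid normals with `C = 1`, `θ ≤ 90°`.

WHAT THIS IS NOT: the rim term of the slab sample; `ν₃ < 0` (inversion image); films mixing
families; rung F-C1 not moved.
-/

noncomputable section

namespace Summit.Ventures.Crystal3D.Theorems

open Summit.Ventures.Crystal3D Finset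
open Literature.MathematicalPhysics.StatisticalMechanics (barlowPos barlowStacking fccStacking
  barlowOffset layerNormal constHagg haggLabel_const barlowPos_apply_two orderedContacts contactDeficiency)
open scoped InnerProductSpace

/-- **The `A`-rule inequality for a given configuration** (regime `C = 1`, abstract labels).  `X` a
unit packing, `P ⊆ X ∩ Λ₀`, film in `B`, every substrate ball `ν`-below every film ball; `τ_a, τ_b, τ_c`
an enumeration of the hollow triple with `α + β_a < 0 < α + β_b, α + β_c` (`α = √(2/3)ν₃ ≥ 0`); the two
closure facts `p + N + τ_a ∈ P`, `p − N − τ_b ∈ P` at film-adjacent substrate balls `p`.  Then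
`#cross(P, X \ P) ≤ contactDeficiency (X \ P)`. -/
theorem oneOverhang_main (X P : Finset (EuclideanSpace ℝ (Fin 3)))
    (hX : ∀ p ∈ X, ∀ q ∈ X, p ≠ q → 1 ≤ dist p q) (hPX : P ⊆ X)
    (ν τa τb τc : EuclideanSpace ℝ (Fin 3))
    (hPΛ : ∀ p ∈ P, p ∈ fccStacking 1 (Real.sqrt (2 / 3)))
    (hfilm : ∀ q ∈ X \ P, q ∈ fccStacking 1 (Real.sqrt (2 / 3)) ∨
      q - barlowOffset 1 ∈ fccStacking 1 (Real.sqrt (2 / 3)) ∨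
      q + barlowOffset 1 ∈ fccStacking 1 (Real.sqrt (2 / 3)))
    (hbelow : ∀ p ∈ P, ∀ q ∈ X \ P, ⟪p, ν⟫_ℝ < ⟪q, ν⟫_ℝ)
    (hT : ∀ τ ∈ ([barlowOffset 1, barlowOffset 1 - barlowPos 1 (Real.sqrt (2 / 3)) constHagg 0 1 0,
        barlowOffset 1 - barlowPos 1 (Real.sqrt (2 / 3)) constHagg 0 0 1] : List (EuclideanSpace ℝ (Fin 3))),
        τ = τa ∨ τ = τb ∨ τ = τc)
    (haT : τa ∈ ([barlowOffset 1, barlowOffset 1 - barlowPos 1 (Real.sqrt (2 / 3)) constHagg 0 1 0,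
        barlowOffset 1 - barlowPos 1 (Real.sqrt (2 / 3)) constHagg 0 0 1] : List (EuclideanSpace ℝ (Fin 3))))
    (hbT : τb ∈ ([barlowOffset 1, barlowOffset 1 - barlowPos 1 (Real.sqrt (2 / 3)) constHagg 0 1 0,
        barlowOffset 1 - barlowPos 1 (Real.sqrt (2 / 3)) constHagg 0 0 1] : List (EuclideanSpace ℝ (Fin 3))))
    (hcT : τc ∈ ([barlowOffset 1, barlowOffset 1 - barlowPos 1 (Real.sqrt (2 / 3)) constHagg 0 1 0,
        barlowOffset 1 - barlowPos 1 (Real.sqrt (2 / 3)) constHagg 0 0 1] : List (EuclideanSpace ℝ (Fin 3))))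
    (hsum : τa + τb + τc = 0)
    (hs0 : 0 ≤ Real.sqrt (2 / 3) * ν 2)
    (ha : Real.sqrt (2 / 3) * ν 2 + ⟪τa, ν⟫_ℝ < 0)
    (hb : 0 < Real.sqrt (2 / 3) * ν 2 + ⟪τb, ν⟫_ℝ)
    (hc : 0 < Real.sqrt (2 / 3) * ν 2 + ⟪τc, ν⟫_ℝ)
    (hclosA : ∀ p ∈ P, ∀ q ∈ X \ P, dist p q = 1 → p + (layerNormal (Real.sqrt (2 / 3)) + τa) ∈ P)
    (hclosB : ∀ p ∈ P, ∀ q ∈ X \ P, dist p q = 1 → p - (layerNormal (Real.sqrt (2 / 3)) + τb) ∈ P) :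
    ((((P ×ˢ (X \ P)).filter fun pq => dist pq.1 pq.2 = 1).card : ℕ) : ℝ) ≤
      contactDeficiency (X \ P) := by
  classical
  set N : EuclideanSpace ℝ (Fin 3) := layerNormal (Real.sqrt (2 / 3)) with hN
  set E3 : List (EuclideanSpace ℝ (Fin 3)) := [barlowPos 1 (Real.sqrt (2 / 3)) constHagg 0 1 0,
    barlowPos 1 (Real.sqrt (2 / 3)) constHagg 0 0 1, barlowPos 1 (Real.sqrt (2 / 3)) constHagg 0 1 (-1)]
    with hE3
  set A : Finset (EuclideanSpace ℝ (Fin 3)) :=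
    {N + τa, N - τb, -(N + τb), -(N + τc), -(N - τa), -(N - τc)} with hA
  -- norms and third coordinates of the hollow vectors
  have hnorm : ∀ τ ∈ ([barlowOffset 1, barlowOffset 1 - barlowPos 1 (Real.sqrt (2 / 3)) constHagg 0 1 0,
      barlowOffset 1 - barlowPos 1 (Real.sqrt (2 / 3)) constHagg 0 0 1] : List (EuclideanSpace ℝ (Fin 3))),
      ‖τ‖ ^ 2 = 1 / 3 := by
    intro τ hτ
    simp only [List.mem_cons, List.mem_nil_iff, or_false] at hτ
    rcases hτ with rfl | rfl | rfl
    exacts [norm_sq_barlowOffset', norm_sq_barlowOffset_sub_u, norm_sq_barlowOffset_sub_v]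
  have hna := hnorm τa haT
  have hnb := hnorm τb hbT
  have hnc := hnorm τc hcT
  have hτ2 : τa 2 = 0 ∧ τb 2 = 0 ∧ τc 2 = 0 :=
    ⟨hollow_apply_two haT, hollow_apply_two hbT, hollow_apply_two hcT⟩
  have hN2 : N 2 ≠ 0 := by
    rw [hN, layerNormal_apply_two]; exact (Real.sqrt_pos.2 (by norm_num)).ne'
  have hE2 : ∀ e ∈ E3, e 2 = 0 := by
    intro e he
    simp only [hE3, List.mem_cons, List.mem_nil_iff, or_false] at he
    rcases he with rfl | rfl | rfl <;> simp [barlowPos_apply_two]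
  have hNν : ⟪N, ν⟫_ℝ = Real.sqrt (2 / 3) * ν 2 := inner_layerNormal_left ν
  -- `A`-slots have nonzero third coordinate, in-plane vectors have zero
  have hA2 : ∀ a ∈ A, a 2 ≠ 0 := by
    intro a haA
    obtain ⟨h2a, h2b, h2c⟩ := hτ2
    simp only [hA, mem_insert, mem_singleton] at haA
    rcases haA with rfl | rfl | rfl | rfl | rfl | rfl <;> simp [h2a, h2b, h2c, hN2]
  -- the transfer
  set s : EuclideanSpace ℝ (Fin 3) → ℤ := fun d =>
    if d ∈ A then 1 else if -d ∈ A then 0 else if ⟪d, ν⟫_ℝ < 0 then 1 else 0 with hs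
  have hs01 : ∀ d, s d = 0 ∨ s d = 1 := by
    intro d; simp only [hs]; split_ifs <;> simp
  set t : EuclideanSpace ℝ (Fin 3) → EuclideanSpace ℝ (Fin 3) → ℤ := fun x y => s (x - y) - s (y - x)
    with ht
  have ht_anti : ∀ x y, t x y = -t y x := fun x y => by simp only [ht]; ring
  have ht_le : ∀ x y, t x y ≤ 1 := fun x y => by
    simp only [ht]; rcases hs01 (x - y) with h | h <;> rcases hs01 (y - x) with h' | h' <;> omega
  -- the flow certificate
  have hmain := adhesion_of_flow X P ∅ hX hPX (empty_subset _) t ht_anti ht_le fun q hq => by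
    rw [sdiff_empty] at hq
    have hqX : q ∈ X := (mem_sdiff.1 hq).1
    have hqP : q ∉ P := (mem_sdiff.1 hq).2
    have hqB := hfilm q hq
    have hB : ∀ y ∈ X, y ∈ fccStacking 1 (Real.sqrt (2 / 3)) ∨
        y - barlowOffset 1 ∈ fccStacking 1 (Real.sqrt (2 / 3)) ∨
        y + barlowOffset 1 ∈ fccStacking 1 (Real.sqrt (2 / 3)) := by
      intro y hy
      by_cases hyP : y ∈ P
      · exact Or.inl (hPΛ y hyP)
      · exact hfilm y (mem_sdiff.2 ⟨hy, hyP⟩)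
    -- classification of the partners
    have hdir : ∀ x ∈ X, dist q x = 1 →
        (∃ e ∈ E3, x - q = e ∨ x - q = -e) ∨
        (∃ τ ∈ [τa, τb, τc], x - q = N + τ ∨ x - q = N - τ ∨ x - q = -(N + τ) ∨ x - q = -(N - τ)) := by
      intro x hx hd
      rcases basal_polar_or_inplane (basal_unit_vectors hqB (hB x hx) hd) with ⟨c, hc', hcx⟩ | ⟨τ, hτ, hτx⟩
      · left
        simp only [List.mem_cons, List.mem_nil_iff, or_false] at hc'
        rcases hc' with rfl | rfl | rfl
        · exact ⟨_, by simp [hE3], hcx⟩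
        · exact ⟨_, by simp [hE3], hcx⟩
        · exact ⟨_, by simp [hE3], hcx⟩
      · right
        refine ⟨τ, ?_, hτx⟩
        rcases hT τ hτ with rfl | rfl | rfl <;> simp
    -- values of the transfer
    have ht_negA : ∀ x ∈ X \ P, dist q x = 1 → q - x ∈ A → x - q ∉ A → t x q ≤ -1 := by
      intro x _ _ h1 h2
      have e1 : s (x - q) = 0 := by
        simp only [hs]; rw [if_neg h2, if_pos (by rw [neg_sub]; exact h1)]
      have e2 : s (q - x) = 1 := by simp only [hs]; rw [if_pos h1]
      simp only [ht]; rw [e1, e2]; norm_num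
    have hip_notA : ∀ x, (∃ e ∈ E3.toFinset, x - q = e ∨ x - q = -e) → x - q ∉ A ∧ q - x ∉ A := by
      rintro x ⟨e, he, hxe⟩
      have he2 : e 2 = 0 := hE2 e (List.mem_toFinset.1 he)
      have hx2 : (x - q) 2 = 0 := by rcases hxe with h | h <;> simp [h, he2]
      have hq2 : (q - x) 2 = 0 := by
        rw [show q - x = -(x - q) by abel, PiLp.neg_apply, hx2, neg_zero]
      exact ⟨fun h => hA2 _ h hx2, fun h => hA2 _ h hq2⟩
    have ht_above : ∀ x ∈ X \ P, dist q x = 1 → (∃ e ∈ E3.toFinset, x - q = e ∨ x - q = -e) →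
        0 < ⟪x - q, ν⟫_ℝ → t x q ≤ -1 := by
      intro x _ _ he hpos
      obtain ⟨h1, h2⟩ := hip_notA x he
      have hneg : ⟪q - x, ν⟫_ℝ < 0 := by rw [← neg_sub, inner_neg_left]; linarith
      have e1 : s (x - q) = 0 := by
        simp only [hs]; rw [if_neg h1, if_neg (by rw [neg_sub]; exact h2), if_neg (by linarith)]
      have e2 : s (q - x) = 1 := by
        simp only [hs]; rw [if_neg h2, if_neg (by rw [neg_sub]; exact h1), if_pos hneg]
      simp only [ht]; rw [e1, e2]; norm_num
    have ht_level : ∀ x ∈ X \ P, dist q x = 1 → (∃ e ∈ E3.toFinset, x - q = e ∨ x - q = -e) →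
        ⟪x - q, ν⟫_ℝ = 0 → t x q ≤ 0 := by
      intro x _ _ he hz
      obtain ⟨h1, h2⟩ := hip_notA x he
      have hz' : ⟪q - x, ν⟫_ℝ = 0 := by rw [← neg_sub, inner_neg_left, hz, neg_zero]
      have e1 : s (x - q) = 0 := by
        simp only [hs]; rw [if_neg h1, if_neg (by rw [neg_sub]; exact h2), if_neg (by rw [hz]; exact lt_irrefl 0)]
      have e2 : s (q - x) = 0 := by
        simp only [hs]; rw [if_neg h2, if_neg (by rw [neg_sub]; exact h1), if_neg (by rw [hz']; exact lt_irrefl 0)]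
      simp only [ht]; rw [e1, e2]; norm_num
    -- substrate partners: ν-below, on a line or at an `A`-slot
    have hplug : ∀ p ∈ P, dist q p = 1 → ⟪p - q, ν⟫_ℝ < 0 ∧
        ((∃ e ∈ E3, p - q = e ∨ p - q = -e) ∨ p - q ∈ A) := by
      intro p hp hd
      have hneg : ⟪p - q, ν⟫_ℝ < 0 := by rw [inner_sub_left]; linarith [hbelow p hp q hq]
      refine ⟨hneg, ?_⟩
      have hd' : dist p q = 1 := by rw [dist_comm]; exact hd
      rcases hdir p (hPX hp) hd with he | ⟨τ, hτ, hτp⟩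
      · exact Or.inl he
      · right
        -- excluded slots lead to contradictions
        have contra : ∀ ℓ : EuclideanSpace ℝ (Fin 3), ℓ ∈ P → ‖q - ℓ‖ ^ 2 = 1 / 3 → False := by
          intro ℓ hℓ hn
          have hne : q ≠ ℓ := fun e => hqP (e ▸ hℓ)
          have h1 := hX q hqX ℓ (hPX hℓ) hne
          rw [dist_eq_norm] at h1
          nlinarith [norm_nonneg (q - ℓ)]
        have hqp : q = p - (p - q) := by abel
        simp only [List.mem_cons, List.mem_nil_iff, or_false] at hτ
        rcases hτ with h1 | h1 | h1 <;> rw [h1] at hτp <;> rcases hτp with h | h | h | h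
        · rw [h, hA]; simp
        · exfalso; rw [h, inner_sub_left, hNν] at hneg; linarith
        · exfalso; rw [h, inner_neg_left, inner_add_left, hNν] at hneg; linarith
        · rw [h, hA]; simp
        · exfalso; rw [h, inner_add_left, hNν] at hneg; linarith
        · rw [h, hA]; simp
        · rw [h, hA]; simp
        · -- `p − q = −(N − τ_b)`: twin ball on `p`; `p + N + τ_a ∈ P` is `√(1/3)` away
          exfalso
          refine contra (p + (N + τa)) (hclosA p hp q hq hd') ?_
          rw [hqp, h, show p - -(N - τb) - (p + (N + τa)) = -(τa + τb) by abel,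
            show τa + τb = -τc by rw [← sub_eq_zero]; rw [← hsum]; abel, neg_neg, hnc]
        · exfalso; rw [h, inner_add_left, hNν] at hneg; linarith
        · -- `p − q = N − τ_c`: twin ball under `p`; `p − N − τ_b ∈ P` is `√(1/3)` away
          exfalso
          refine contra (p - (N + τb)) (hclosB p hp q hq hd') ?_
          rw [hqp, h, show p - (N - τc) - (p - (N + τb)) = τb + τc by abel,
            show τb + τc = -τa by rw [← sub_eq_zero]; rw [← hsum]; abel, norm_neg, hna]
        · rw [h, hA]; simp
        · rw [h, hA]; simp
    exact aRule_T2_core X P hX hPX q ν N τa τb τc E3 (by simp [hE3]) hE2 hN2 hτ2 hna hnb hnc hsum t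
      (fun x => ht_le x q) ht_negA ht_above ht_level hdir hplug
  simpa using hmain

/-- **The atom for single-family Barlow films in regime `C = 1` (one overhanging registry slot),
via the `A`-rule flow** (`R = 1`, `C = 0`; registered by name on stmt-Ventures-19144).  Hypotheses:
`ν₃ ≥ 0`; exactly one hollow vector `τ` with `√(2/3)ν₃ + ⟪τ,ν⟫ < 0`, the other two `> 0`; film in
`Λ₀ ∪ (Λ₀ ± w)` and above the cut; every substrate ball touching the film has all its `ν`-downward
lattice neighbours in `P`. -/
theorem oneOverhangBarlowFilm_adhesion :
    ∃ R C : ℝ, 1 ≤ R ∧ ∀ ν : EuclideanSpace ℝ (Fin 3), ‖ν‖ = 1 → ∀ ρ : ℝ, R ≤ ρ →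
      ∀ X P : Finset (EuclideanSpace ℝ (Fin 3)),
      (∀ p ∈ X, ∀ q ∈ X, p ≠ q → 1 ≤ dist p q) → P ⊆ X →
      (∀ p, p ∈ P ↔ (p ∈ fccStacking 1 (Real.sqrt (2 / 3)) ∧ -(2 * R) ≤ ⟪p, ν⟫_ℝ ∧
        ⟪p, ν⟫_ℝ ≤ -R ∧ ‖p‖ ^ 2 - ⟪p, ν⟫_ℝ ^ 2 ≤ ρ ^ 2)) →
      0 ≤ ν 2 →
      ((Real.sqrt (2 / 3) * ν 2 + ⟪barlowOffset 1, ν⟫_ℝ < 0 ∧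
          0 < Real.sqrt (2 / 3) * ν 2 + ⟪barlowOffset 1 - barlowPos 1 (Real.sqrt (2 / 3)) constHagg 0 1 0, ν⟫_ℝ ∧
          0 < Real.sqrt (2 / 3) * ν 2 + ⟪barlowOffset 1 - barlowPos 1 (Real.sqrt (2 / 3)) constHagg 0 0 1, ν⟫_ℝ) ∨
        (Real.sqrt (2 / 3) * ν 2 + ⟪barlowOffset 1 - barlowPos 1 (Real.sqrt (2 / 3)) constHagg 0 1 0, ν⟫_ℝ < 0 ∧
          0 < Real.sqrt (2 / 3) * ν 2 + ⟪barlowOffset 1, ν⟫_ℝ ∧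
          0 < Real.sqrt (2 / 3) * ν 2 + ⟪barlowOffset 1 - barlowPos 1 (Real.sqrt (2 / 3)) constHagg 0 0 1, ν⟫_ℝ) ∨
        (Real.sqrt (2 / 3) * ν 2 + ⟪barlowOffset 1 - barlowPos 1 (Real.sqrt (2 / 3)) constHagg 0 0 1, ν⟫_ℝ < 0 ∧
          0 < Real.sqrt (2 / 3) * ν 2 + ⟪barlowOffset 1, ν⟫_ℝ ∧
          0 < Real.sqrt (2 / 3) * ν 2 + ⟪barlowOffset 1 - barlowPos 1 (Real.sqrt (2 / 3)) constHagg 0 1 0, ν⟫_ℝ)) →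
      (∀ q ∈ X \ P, q ∈ fccStacking 1 (Real.sqrt (2 / 3)) ∨
        q - barlowOffset 1 ∈ fccStacking 1 (Real.sqrt (2 / 3)) ∨
        q + barlowOffset 1 ∈ fccStacking 1 (Real.sqrt (2 / 3))) →
      (∀ q ∈ X \ P, -R < ⟪q, ν⟫_ℝ) →
      (∀ p ∈ P, ∀ q ∈ X \ P, dist p q = 1 →
        ∀ d ∈ ([barlowPos 1 (Real.sqrt (2 / 3)) constHagg 0 1 0, -barlowPos 1 (Real.sqrt (2 / 3)) constHagg 0 1 0,
            barlowPos 1 (Real.sqrt (2 / 3)) constHagg 0 0 1, -barlowPos 1 (Real.sqrt (2 / 3)) constHagg 0 0 1,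
            barlowPos 1 (Real.sqrt (2 / 3)) constHagg 0 1 (-1), -barlowPos 1 (Real.sqrt (2 / 3)) constHagg 0 1 (-1),
            barlowPos 1 (Real.sqrt (2 / 3)) constHagg 1 0 0, -barlowPos 1 (Real.sqrt (2 / 3)) constHagg 1 0 0,
            barlowPos 1 (Real.sqrt (2 / 3)) constHagg (-1) 1 0, -barlowPos 1 (Real.sqrt (2 / 3)) constHagg (-1) 1 0,
            barlowPos 1 (Real.sqrt (2 / 3)) constHagg (-1) 0 1, -barlowPos 1 (Real.sqrt (2 / 3)) constHagg (-1) 0 1] :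
            List (EuclideanSpace ℝ (Fin 3))),
          ⟪d, ν⟫_ℝ < 0 → p + d ∈ P) →
      ((((P ×ˢ (X \ P)).filter fun pq => dist pq.1 pq.2 = 1).card : ℕ) : ℝ) ≤
        contactDeficiency (X \ P) + C * ρ := by
  classical
  refine ⟨1, 0, le_rfl, fun ν hν ρ hρ X P hX hPX hP hν2 hreg hfilm habove hclos => ?_⟩
  rw [zero_mul, add_zero]
  set w : EuclideanSpace ℝ (Fin 3) := barlowOffset 1 with hw
  set wu : EuclideanSpace ℝ (Fin 3) := barlowOffset 1 - barlowPos 1 (Real.sqrt (2 / 3)) constHagg 0 1 0 with hwu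
  set wv : EuclideanSpace ℝ (Fin 3) := barlowOffset 1 - barlowPos 1 (Real.sqrt (2 / 3)) constHagg 0 0 1 with hwv
  have hsum : w + wu + wv = 0 := hollow_triple_sum
  have hs0 : 0 ≤ Real.sqrt (2 / 3) * ν 2 := mul_nonneg (Real.sqrt_nonneg _) hν2
  have hPΛ : ∀ p ∈ P, p ∈ fccStacking 1 (Real.sqrt (2 / 3)) := fun p hp => ((hP p).1 hp).1
  have hbelow : ∀ p ∈ P, ∀ q ∈ X \ P, ⟪p, ν⟫_ℝ < ⟪q, ν⟫_ℝ := fun p hp q hq => by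
    obtain ⟨-, -, h2, -⟩ := (hP p).1 hp
    linarith [habove q hq]
  obtain ⟨e1, e2, e3, -, -, -⟩ := polar_vectors_eq
  have hNν : ⟪layerNormal (Real.sqrt (2 / 3)), ν⟫_ℝ = Real.sqrt (2 / 3) * ν 2 := inner_layerNormal_left ν
  -- the closure facts in `± N ± τ` form
  have clos : ∀ τ ∈ ([w, wu, wv] : List (EuclideanSpace ℝ (Fin 3))),
      (Real.sqrt (2 / 3) * ν 2 + ⟪τ, ν⟫_ℝ < 0 →
        ∀ p ∈ P, ∀ q ∈ X \ P, dist p q = 1 → p + (layerNormal (Real.sqrt (2 / 3)) + τ) ∈ P) ∧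
      (0 < Real.sqrt (2 / 3) * ν 2 + ⟪τ, ν⟫_ℝ →
        ∀ p ∈ P, ∀ q ∈ X \ P, dist p q = 1 → p - (layerNormal (Real.sqrt (2 / 3)) + τ) ∈ P) := by
    intro τ hτ
    have hup : ⟪layerNormal (Real.sqrt (2 / 3)) + τ, ν⟫_ℝ = Real.sqrt (2 / 3) * ν 2 + ⟪τ, ν⟫_ℝ := by
      rw [inner_add_left, hNν]
    simp only [List.mem_cons, List.mem_nil_iff, or_false] at hτ
    rcases hτ with rfl | rfl | rfl
    · refine ⟨fun hlt p hp q hq hd => ?_, fun hgt p hp q hq hd => ?_⟩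
      · rw [← e1]; exact hclos p hp q hq hd _ (by simp) (by rw [e1, hup]; exact hlt)
      · rw [← e1, sub_eq_add_neg]
        exact hclos p hp q hq hd _ (by simp) (by rw [inner_neg_left, e1, hup]; linarith)
    · refine ⟨fun hlt p hp q hq hd => ?_, fun hgt p hp q hq hd => ?_⟩
      · rw [show layerNormal (Real.sqrt (2 / 3)) + (barlowOffset 1 - barlowPos 1 (Real.sqrt (2 / 3)) constHagg 0 1 0)
            = -barlowPos 1 (Real.sqrt (2 / 3)) constHagg (-1) 1 0 by rw [e2, neg_neg]]
        exact hclos p hp q hq hd _ (by simp) (by rw [inner_neg_left, e2, inner_neg_left, hup]; linarith)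
      · rw [show p - (layerNormal (Real.sqrt (2 / 3)) + (barlowOffset 1 - barlowPos 1 (Real.sqrt (2 / 3)) constHagg 0 1 0))
            = p + barlowPos 1 (Real.sqrt (2 / 3)) constHagg (-1) 1 0 by rw [e2]; abel]
        exact hclos p hp q hq hd _ (by simp) (by rw [e2, inner_neg_left, hup]; linarith)
    · refine ⟨fun hlt p hp q hq hd => ?_, fun hgt p hp q hq hd => ?_⟩
      · rw [show layerNormal (Real.sqrt (2 / 3)) + (barlowOffset 1 - barlowPos 1 (Real.sqrt (2 / 3)) constHagg 0 0 1)
            = -barlowPos 1 (Real.sqrt (2 / 3)) constHagg (-1) 0 1 by rw [e3, neg_neg]]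
        exact hclos p hp q hq hd _ (by simp) (by rw [inner_neg_left, e3, inner_neg_left, hup]; linarith)
      · rw [show p - (layerNormal (Real.sqrt (2 / 3)) + (barlowOffset 1 - barlowPos 1 (Real.sqrt (2 / 3)) constHagg 0 0 1))
            = p + barlowPos 1 (Real.sqrt (2 / 3)) constHagg (-1) 0 1 by rw [e3]; abel]
        exact hclos p hp q hq hd _ (by simp) (by rw [e3, inner_neg_left, hup]; linarith)
  have hTall : ∀ τ ∈ ([w, wu, wv] : List (EuclideanSpace ℝ (Fin 3))), τ = w ∨ τ = wu ∨ τ = wv := by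
    intro τ hτ; simpa using hτ
  rcases hreg with ⟨ha, hb, hc⟩ | ⟨ha, hb, hc⟩ | ⟨ha, hb, hc⟩
  · exact oneOverhang_main X P hX hPX ν w wu wv hPΛ hfilm hbelow
      (fun τ hτ => by simp only [List.mem_cons, List.mem_nil_iff, or_false] at hτ; tauto)
      (by simp [hw]) (by simp [hwu]) (by simp [hwv]) hsum hs0 ha hb hc
      ((clos w (by simp)).1 ha) ((clos wu (by simp)).2 hb)
  · exact oneOverhang_main X P hX hPX ν wu w wv hPΛ hfilm hbelow
      (fun τ hτ => by simp only [List.mem_cons, List.mem_nil_iff, or_false] at hτ; tauto)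
      (by simp [hwu]) (by simp [hw]) (by simp [hwv]) (by rw [← hsum]; abel) hs0 ha hb hc
      ((clos wu (by simp)).1 ha) ((clos w (by simp)).2 hb)
  · exact oneOverhang_main X P hX hPX ν wv w wu hPΛ hfilm hbelow
      (fun τ hτ => by simp only [List.mem_cons, List.mem_nil_iff, or_false] at hτ; tauto)
      (by simp [hwv]) (by simp [hw]) (by simp [hwu]) (by rw [← hsum]; abel) hs0 ha hb hc
      ((clos wv (by simp)).1 ha) ((clos w (by simp)).2 hb)

end Summit.Ventures.Crystal3D.Theorems

end
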